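import Summits.PneNP.PneNP.Theses.UncheckableSAT

/-!
# Crux `Thesis` (stmt-PneNP-2298) — the strategist's typed split (glue for `route edit --split`)

WORKFILE COPY (namespace `…Cruxes.Thesis.SplitGlue`) of the Theorems-ready file `UncheckableSATThesisSplit.lean` attached as
item evidence (planner seats cannot propose into Theorems — perm.theorems-prover-only); a prover lands it verbatim as
`Summits/PneNP/PneNP/Theorems/UncheckableSATThesisSplit.lean` (`--supports stmt-PneNP-2298`), after which
`route edit --split Thesis --into children.json --glue-by Summit.PneNP.PneNP.Theorems.uncheckableSAT_thesis_of_subs` applies.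

Crux-strategist DECOMPOSITION (BC2 redirect, human ruling 2026-08-16) of
`Summit.PneNP.PneNP.Theses.UncheckableSAT.Thesis` — X := "UNSAT has no interactive proof (the tree's `IPVerifier`
template: private coins, `|x|^c` messages, completeness `2/3` with the uniform honest prover, soundness `1/3` against
all provers) whose honest prover is a polynomial-time SAT-oracle machine" — into STRUCTURE × HARDNESS:

  X ⇐ ProversMustCount ∧ BPPNPCannotCountMod.

CHILDREN (the two hypotheses below, verbatim the `statement`s filed with `route edit --split Thesis`):
* `ProversMustCount` — "provers of unsatisfiability must count": for EVERY language `K`, an interactive proof for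
  `UNSAT` in the Thesis' own template whose honest prover is in `FP^K` forces `Mod_mP ⊆ BPP^K` for some modulus
  `m ≥ 2` (`Mod_mP` = Beigel–Gill's class, `x ∈ L ↔ m ∤ #{y ∈ {0,1}^{p|x|} | ⟨x,y⟩ ∈ R}`, `R ∈ P`, written inline with
  the tree's `countWitnesses`). True at every KNOWN rung of the prover-power ladder (LFKN/Shamir: `FP^{#P}`
  provers, all `m`; `GF(p^k)`-sumcheck with Valiant–Vazirani isolation: `FP^{Mod_pP}` provers, `m = p`) and
  consistent with `P = NP` (it then asks `Mod_mP ⊆ BPP` for some `m`, which contradicts nothing known); it does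
  NOT imply `P ≠ NP` or X by any cheap means (probes recorded in the strategist's census).
* `BPPNPCannotCountMod` — "approximate counting cannot count exactly": `Mod_mP ⊄ BPP^{SAT} (= BPP^{NP})` for every
  `m ≥ 2`; implied by "PH is infinite" (Toda–Ogiwara `PH ⊆ BP·Mod_pP`; `BPP^{NP} ⊆ Σ₃ᵖ`) and NOT known to imply
  `P ≠ NP` (`P = NP ∧ Mod_mP ≠ P` contradicts nothing known).

THEOREM `uncheckableSAT_thesis_of_subs`: the assembly `ProversMustCount → BPPNPCannotCountMod → Thesis`, modus
ponens at `K := SAT` (a `trivial_seam` in the sense of the ruling — flagged, not disqualifying). Sources for the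
shape: Arora–Barak 2009 §8.4 ("the prover needs at the very least to compute #SAT_D"), Lund–Fortnow–Karloff–Nisan
1992, Babai–Fortnow 1991 (arithmetisation over finite fields), Beigel–Gill 1992 (`Mod_kP`), Toda–Ogiwara 1992.
-/

set_option linter.dupNamespace false

namespace Summit.PneNP.PneNP.Cruxes.Thesis.SplitGlue

open _root_.Computability
open Literature.Computability.Complexity

/-- **Typed split of the crux `Thesis` (stmt-PneNP-2298), arrow form for `route edit --split … --glue-by`**:
"provers of unsatisfiability must count" (`ProversMustCount`, first hypothesis, verbatim the filed child) and
"`BPP^NP` cannot count modulo any `m ≥ 2`" (`BPPNPCannotCountMod`, second hypothesis, verbatim) give the Thesis —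
a competitive (`FP^SAT`-prover) interactive proof for `UNSAT` would, by the first at `K := SAT`, put some `Mod_mP`
inside `BPP^SAT`, which the second forbids. [cite: AroraBarakCC2009, §8.4 and Def. 8.6] [cite: BeigelGill1992, Def. 2.1]
[cite: TodaOgiwara1992, Thm. 1] -/
theorem uncheckableSAT_thesis_of_subs :
    (∀ (V : Literature.Computability.Complexity.IPVerifier) (c : ℕ) (M : List Bool → List Bool) (K : Language Bool), V.IsPolyTime → M ∈ Literature.Computability.Complexity.FPRel (Literature.Computability.Complexity.Oracle.ofLanguage K) → (∀ x ∈ Literature.Computability.Complexity.UNSAT, (2 / 3 : ℝ) ≤ V.acceptProb (x.length ^ c) x (fun msgs => M (Literature.Computability.Complexity.boolPair x ((Computability.encodingList Bool).listBool.encode msgs)))) → (∀ x ∉ Literature.Computability.Complexity.UNSAT, ∀ P : Literature.Computability.Complexity.IPProver, V.acceptProb (x.length ^ c) x P ≤ 1 / 3) → ∃ m : ℕ, 2 ≤ m ∧ {L : Language Bool | ∃ R ∈ Literature.Computability.Complexity.Classes.P, ∃ p : Polynomial ℕ, ∀ x : List Bool, x ∈ L ↔ ¬ (m ∣ Literature.Computability.Complexity.countWitnesses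 R (p.eval x.length) x)} ⊆ Literature.Computability.Complexity.BPPRel (Literature.Computability.Complexity.Oracle.ofLanguage K)) →
    (∀ m : ℕ, 2 ≤ m → ¬ ({L : Language Bool | ∃ R ∈ Literature.Computability.Complexity.Classes.P, ∃ p : Polynomial ℕ, ∀ x : List Bool, x ∈ L ↔ ¬ (m ∣ Literature.Computability.Complexity.countWitnesses R (p.eval x.length) x)} ⊆ Literature.Computability.Complexity.BPPRel (Literature.Computability.Complexity.Oracle.ofLanguage Literature.Computability.Complexity.SAT))) →
    Summit.PneNP.PneNP.Theses.UncheckableSAT.Thesis := by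
  intro h₁ h₂
  rintro ⟨V, c, M, hV, hM, hC, hS⟩
  obtain ⟨m, hm, hsub⟩ := h₁ V c M Literature.Computability.Complexity.SAT hV hM hC hS
  exact h₂ m hm hsub

end Summit.PneNP.PneNP.Cruxes.Thesis.SplitGlue
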